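import Mathlib
import Summits.Ventures.HodgeRepro2.T5MuInvariantPadic
import Summits.Ventures.HodgeRepro2.T5ClopenCosets

/-!
# T5MuInvariantCosets — the μ-invariant as an infimum over OPEN COSETS: «μ = inf over opens» in the
  prose's literal vocabulary

Tier-5 support of seat p7 (route/T5-CHECK-G-p7.md §3 S1 / S4 «μ = inf over opens»;
route/T5-LEAN-p7.md §58).  T5MuInvariantPadic defines `mu m := ⨅ U clopen, vp (m 1_U)` on a
profinite space; on a profinite GROUP the prose's «opens» are the cosets `x • H` of open subgroups
(every clopen set is a finite disjoint union of them — T5ClopenCosets).  This file shows the two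
infima agree: `mu_eq_iInf_cosets`.

Mechanism: `1_U = ∑_{x ∈ s} 1_{x • H}` for a clopen `U` (T5ClopenCosets), hence
`m 1_U = ∑ m 1_{x • H}`, and the `p`-adic valuation of a finite sum is at least the minimum of the
valuations (the ultrametric inequality through `‖·‖ ≤ p^{−n} ↔ n ≤ vp`).

Nothing about Katz measures or p-adic L-functions is asserted.  Axioms: standard.
README §8(d): uses an L-value-free non-vanishing device: NO.
-/

namespace Summit.Ventures.HodgeRepro2.T5MuInvariantCosets

open Set Pointwise T5MeasureSupOnClopens T5MuInvariantPadic T5ClopenCosets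

variable (p : ℕ) [hp : Fact (Nat.Prime p)]

section Valuation

/-- The valuation of a finite sum is at least the minimum of the valuations (ultrametric). -/
theorem natCast_le_vp_sum {ι : Type*} (s : Finset ι) (f : ι → ℤ_[p]) (n : ℕ)
    (h : ∀ i ∈ s, (n : ℕ∞) ≤ vp p (f i)) : (n : ℕ∞) ≤ vp p (∑ i ∈ s, f i) := by
  rw [← norm_le_pow_iff]
  apply IsUltrametricDist.norm_sum_le_of_forall_le_of_nonneg (by positivity)
  intro i hi
  exact (norm_le_pow_iff p (f i) n).mpr (h i hi)

/-- `⨅ vp (f i) ≤ vp (∑ f i)` over a finite index set: the valuation of a sum is at least the infimum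
of the valuations. -/
theorem iInf_vp_le_vp_sum {ι : Type*} (s : Finset ι) (f : ι → ℤ_[p]) :
    (⨅ i ∈ s, vp p (f i)) ≤ vp p (∑ i ∈ s, f i) := by
  apply le_of_forall_natCast_le
  intro n hn
  apply natCast_le_vp_sum
  intro i hi
  exact hn.trans (iInf₂_le i hi)

end Valuation

section Cosets

variable {G : Type*} [Group G] [TopologicalSpace G] [IsTopologicalGroup G] [CompactSpace G]

omit [CompactSpace G] in
/-- `1_U = ∑_{x ∈ s} 1_{x • H}` in `C(G, ℤ_p)` for a decomposition of the clopen `U` into pairwise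
distinct cosets of an open subgroup `H`. -/
theorem indicatorCM_eq_sum (H : OpenSubgroup G) (s : Finset G)
    (hs : ∀ x ∈ s, ∀ y ∈ s, x • (H : Set G) = y • (H : Set G) → x = y) :
    (indicatorCM (⋃ x ∈ s, x • (H : Set G)) : C(G, ℤ_[p])) =
      ∑ x ∈ s, (indicatorCM (x • (H : Set G)) : C(G, ℤ_[p])) := by
  have hU : IsClopen (⋃ x ∈ s, x • (H : Set G)) :=
    Set.Finite.isClopen_biUnion (Finset.finite_toSet s) fun x _ => isClopen_smul H x
  ext z
  rw [ContinuousMap.sum_apply, indicatorCM_apply hU]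
  have h : (⋃ x ∈ s, x • (H : Set G)).indicator (fun _ => (1 : ℤ_[p])) z =
      ∑ x ∈ s, (x • (H : Set G)).indicator (fun _ => (1 : ℤ_[p])) z :=
    indicator_eq_sum_indicator_smul (M := ℤ_[p]) (H : Subgroup G) s hs 1 z
  simp only [Pi.one_def]
  rw [h]
  refine Finset.sum_congr rfl fun x _ => ?_
  rw [indicatorCM_apply (isClopen_smul H x)]
  rfl

/-- The infimum of `vp (m 1_{x • H})` over all open subgroups `H` and all `x` — «inf over open
cosets». -/
noncomputable def muCosets (m : C(G, ℤ_[p]) →ₗ[ℤ_[p]] ℤ_[p]) : ℕ∞ :=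
  ⨅ (H : OpenSubgroup G) (x : G), vp p (m (indicatorCM (x • (H : Set G))))

omit [IsTopologicalGroup G] [CompactSpace G] in
/-- `muCosets m ≤ vp (m 1_{x • H})`. -/
theorem muCosets_le (m : C(G, ℤ_[p]) →ₗ[ℤ_[p]] ℤ_[p]) (H : OpenSubgroup G) (x : G) :
    muCosets p m ≤ vp p (m (indicatorCM (x • (H : Set G)))) := by
  unfold muCosets
  exact (iInf_le _ H).trans (iInf_le _ x)

/-- **«μ = inf over opens», literally**: the infimum over clopen sets equals the infimum over cosets
of open subgroups. -/
theorem mu_eq_muCosets (m : C(G, ℤ_[p]) →ₗ[ℤ_[p]] ℤ_[p]) : mu p m = muCosets p m := by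
  apply le_antisymm
  · -- every coset is clopen
    apply le_iInf; intro H
    apply le_iInf; intro x
    exact mu_le p m (isClopen_smul H x)
  · -- every clopen set is a finite union of cosets; m 1_U = ∑ m 1_{x • H}
    apply le_iInf
    rintro ⟨U, hU⟩
    obtain ⟨H, s, -, hs, rfl⟩ := exists_finset_eq_biUnion_smul hU
    rw [indicatorCM_eq_sum p H s hs, map_sum]
    refine le_trans ?_ (iInf_vp_le_vp_sum p s _)
    apply le_iInf; intro x
    apply le_iInf; intro _
    exact muCosets_le p m H x

end Cosets

end Summit.Ventures.HodgeRepro2.T5MuInvariantCosets
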